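import Summits.BirchSwinnertonDyer.BirchSwinnertonDyer.Theses.GenusKolyvaginAtTwo
import Summits.BirchSwinnertonDyer.BirchSwinnertonDyer.Theorems.GenusKolyvaginAtTwoMinimalTwinBSDTwoSwappedPairSilentDescent
import Summits.BirchSwinnertonDyer.BirchSwinnertonDyer.Theorems.GenusKolyvaginAtTwoGenusPrimitiveSupplyAtTwoTwinConverse
import Literature.NumberTheory.EllipticCurves.KrizLi2019.AssumptionStarTwoPrimitiveProofs
import Literature.NumberTheory.EllipticCurves.BoxerDiao2010.TamagawaTwistHolds
import Literature.NumberTheory.EllipticCurves.TwoAdicImageSurjectivityModTwoProofs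
import HarnessLib

/-!
# Route `GenusKolyvaginAtTwo`, crux U₂ `MinimalTwinBSDTwo` (stmt-BirchSwinnertonDyer-22985), LINE 23 «twin_swap»:
# KRIZ–LI'S ASSUMPTION (★) AS A PER-PAIR CERTIFICATE for the line's exponent clause and for the depth-zero kernel K₁ —
# on the (★)-locus the registered supply stub S2″ is a `2`-Selmer-trivial-twin certificate and U₂ needs only the wall

Seat `bsd-line-gk2-p2` g24 (PROVER 2/3, cell `bsd-f1-sign2`; LINE 23 holder), `--supports stmt-BirchSwinnertonDyer-22985` (helper; closes
nothing).  THEOREMS ONLY (no definition, no named fact, no `sorry`); standard axioms.  **BSD is NOT proved by this file; U₂ / hTw / K₁ are NOT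
proved; no item is closed.**  §1–§3 are UNCONDITIONAL (Kriz–Li's Assumption (★) is a displayed HYPOTHESIS — per pair `(E, K)` a finite `2`-adic
computation, Kriz–Li 2019 Ex. 6.1–6.2 / Table 1; no curve is shown to satisfy it here); §4 is CONDITIONAL (D-0014) on the four STATEMENT-ONLY
published facts the route carries as items (Gross–Zagier 24148, GZK 19921, modularity 19273, Milne any-model 24149) and on LINE 23's anchor S1
(the rank-`0` wall on `2`-Selmer-trivial curves), displayed.

PRESEARCH (this seat, for the registered stubs S2″ `ReversedMinimalSupplyAtTwoExponent` / S2⁻ `ReversedMinimalSupplyAtTwoDepthOne`): the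
reversed `2`-Selmer-trivial Heegner twin supply WITH its exponent clause is IN PRINT on Kriz–Li's families — [corpus: doi-10-1017-fms-2019-9,
Thm. 4.3 / Thm. 5.1 / §5.1 Lemma 5.4, Cor. 5.5, Lemmas 5.9–5.12 (FMS p. 27–32)]: for `E` with `E(ℚ)[2] = 0`, a Heegner field `K` with `2` SPLIT
and Assumption (★) («`|Ẽ^{ns}(𝔽₂)|·log_{ω_E}(P)/2 ≢ 0 (mod 2)`»), `c₂(E)` odd: `P` is `2`-PRIMITIVE in `E(K)` (Lemma 5.4), all `c_ℓ(E)` are odd,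
`Sel₂(E/K)` has rank one, and all of this PROPAGATES to `E^(d)`, `d ∈ 𝒩` (square-free products of silent primes split in `K`), whence BSD(2)
moves from the anchor pair `(E, E^(d_K))` to every `(E^(d), E^(d·d_K))` (Thm. 5.1 (2); tree named fact `KrizLi2019.thm112_bsdTwo_twist`).  NOT in
print: the supply for EVERY rank-`1` minimal curve (Kriz–Li Rem. 1.14: «not known in general how to show this directly»), and anything on the
even-`C(E)` cell of S2⁻ ((★) forces all `c_ℓ` odd).  The tree PROVES the first step of Lemma 5.4 (`KrizLi2019.not_exists_two_zsmul_eq_of_assumptionStar`,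
`…not_isOfFinAddOrder_of_assumptionStar`; cmk2-p1 used it on the CM habitat, `KolyvaginLowerTwo.…`).  This file reads it on the GK2 frames:

* §1 `not_isOfFinAddOrder_and_not_twoDiv_derivedPoint_of_assumptionStar` — `E(ℚ)[2] = 0`, `c₂(E)` odd, `K` odd-`d_K` Heegner, an odd-`c` datum,
  `P₀ ∈ E(K)` under `P(1)`, `j : K → ℚ₂` with (★) ⟹ `P(1)` has infinite order AND `P(1) ∉ 2E(K[1])` (McCallum 5.1 descent; adapted from
  cmk2-p1's `KolyvaginLowerTwo.not_isOfFinAddOrder_and_not_twoDivisible_of_assumptionStar` with `ρ̄₂`-onto replaced by `E(ℚ)[2] = 0`;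
  `c₂(E)` odd from `C(E)` odd by `c₂ ∣ C(E)`, as in cmk2-p1's `KolyvaginLowerTwo.odd_localTamagawaNumber_two_of_odd_tamagawaProduct`).
* §2 (SWAPPED frame, LINE 23) **`reversedSupplyExponent_clauses_of_assumptionStar`** — at a rank-`1`, `#Sel₂ = 2`, odd-`C(W)` curve with a
  (★)-certified Heegner pair and a `2`-Selmer-trivial twin, ALL point-clauses of S2″ hold with `M₀ = 0 = v₂(c)`: on the (★)-locus the registered
  supply stub S2″ is EXACTLY «(★) ∧ the twin `W^(d_K)` is `2`-Selmer-trivial inside the budget» — two per-pair computable certificates;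
  `reversedMinimalSupplyAtTwoExponent_of_starTwinSupply` — S2″ (text VERBATIM) ⟸ the (★)-certified twin supply S2★.
* §3 (HABITAT frame, kernel K₁) **`twoDivExponent_eq_zero_of_assumptionStar`** / **`K1_frame_of_assumptionStar`** — at ANY frame of the route
  (`ρ̄_{E,2}` onto, `C(E)` odd, odd-`c` datum, `2^(M₀) ∥ P(1)`) carrying a (★) certificate, `M₀ = 0`; so the depth-zero kernels K₁ (31525) /
  K₁⁺ (31468) HOLD AT EVERY (★)-CERTIFIED FRAME (their `1 ≤ M₀ → False` by contradiction) — unconditional; beyond print only OFF the (★)-locus.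
* §4 (U₂ on the (★)-locus) **`bsdp_of_wall_of_assumptionStar_twinTrivial_of_facts`** — `W` non-CM, `r_an = 1`, `#Sel₂ = 2`, `C(W)` odd; `K`
  odd `d_K ≠ −3` Heegner with a (★)-certified odd-`c` frame; `Wd` a globally minimal `2`-Selmer-trivial twin inside the budget; S1 (wall) +
  PRINT ⟹ **`BSDp W 2`** (g23's Manin-free S3″ `swappedPairDescentAtTwo_maninExponent_of_facts` p766443 at `M₀ = 0`): **on the (★)-locus LINE 23
  needs NO supply statement beyond two certificates — only the wall.**

References: [KrizLi2019] FMS Thm. 1.12/5.1, §4 (★), Thm. 4.3, Lemma 5.4, Cor. 5.5, Rem. 1.14, Ex. 6.1–6.2; [McCallumLMS1991] §5 Lemma 5.1;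
[GrossLMS1991] §5 Prop. 5.3; [GrossZagier1986] V.§2 (2.2); [Milne1972ArithmeticAV] §1 Thm. 1; [SilvermanAEC2009] Cor. VII.6.2; [Miller2011LMS]
Def. 1.1.
-/

set_option autoImplicit false
set_option linter.dupNamespace false -- `Summit.<P>.<Sub>` repeats `BirchSwinnertonDyer` (D-0017)

noncomputable section

open scoped Classical

open WeierstrassCurve NumberField Literature.NumberTheory.EllipticCurves
  Literature.NumberTheory.EllipticCurves.ModularForms
  Literature.NumberTheory.EllipticCurves.Rank1Residual
  Literature.NumberTheory.EllipticCurves.Rank1Residual.Typed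
  Literature.NumberTheory.EllipticCurves.KrizLi2019
  Summit.BirchSwinnertonDyer.Rank1Residual
  Summit.BirchSwinnertonDyer.Rank1Residual.AdditivePotMult
  Summit.BirchSwinnertonDyer.BirchSwinnertonDyer.Theses.GenusKolyvaginAtTwo
  Summit.BirchSwinnertonDyer.BirchSwinnertonDyer.Theorems.CMExactDescent
  Summit.BirchSwinnertonDyer.BirchSwinnertonDyer.Theorems.GenusExact.TwinSwap

namespace Summit.BirchSwinnertonDyer.BirchSwinnertonDyer.Theorems.GenusExact.TwinSwap.Star

/-! ## §1 (★) at the level-`1` frame: `P(1)` has infinite order and is `2`-indivisible in `E(K[1])` -/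

/-- **(★) ⟹ `P(1)` of infinite order and `P(1) ∉ 2E(K[1])`.**  `W/ℚ` globally minimal with `E(ℚ)[2] = 0` (`hT2`) and `c₂(E)` odd; `K` imaginary
quadratic with odd `d_K`, Heegner; a datum `Dt` with odd `Dt.c`; a level-`1` Kolyvagin–Heegner datum `d₁`; `P₀ ∈ E(K)` mapping to
`P(1) = d₁.derivedPoint`; `j : K → ℚ₂` with Kriz–Li's `AssumptionStar W Dt K P₀ j`.  Then `P(1)` has infinite order and is not `2`-divisible in
`E(K[1])`: (★) makes `P₀ ∉ 2E(K) + E(K)_tors` (Kriz–Li Lemma 5.4, first step — tree `KrizLi2019.not_exists_two_zsmul_eq_of_assumptionStar`), and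
McCallum's Lemma 5.1 descent along `E(K) ↪ E(K[1])` (`E(K[1])` has no `2`-torsion since `E(ℚ)` has none, `d_K` odd, Heegner) moves this to
`E(K[1])`.  Adapted from cmk2-p1's `KolyvaginLowerTwo.not_isOfFinAddOrder_and_not_twoDivisible_of_assumptionStar` (`ρ̄₂` onto ↦ `E(ℚ)[2] = 0`).
[cite: KrizLi2019, Lemma 5.4 (FMS), proof] [cite: McCallumLMS1991, §5 Lemma 5.1] -/
theorem not_isOfFinAddOrder_and_not_twoDiv_derivedPoint_of_assumptionStar
    (W : WeierstrassCurve ℚ) [W.IsElliptic] [W.IsGloballyMinimal] [NeZero (W.conductorNorm ℤ)]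
    (hT2 : ∀ P : W.toAffine.Point, 2 • P = 0 → P = 0)
    (hc2 : haveI : Fact (Nat.Prime 2) := ⟨Nat.prime_two⟩; Odd ((W.baseChange ℚ_[2]).localTamagawaNumber ℤ_[2]))
    (K : Type) [Field K] [NumberField K] (hIQ : IsImaginaryQuadratic K) (hodd : Odd (NumberField.discr K))
    (hHe : SatisfiesHeegnerHypothesis (W.conductorNorm ℤ) K)
    (Dt : ModularParametrizationData W (W.conductorNorm ℤ)) (hc : Odd Dt.c) (β : ℤ) (ι : K →+* ℂ)
    (d₁ : KolyvaginHeegnerData Dt β ι 1) (P₀ : (W.baseChange K).toAffine.Point)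
    (hP₀K : WeierstrassCurve.Affine.Point.map (W' := W) (algebraMap K (ringClassField K ι 1)).toRatAlgHom P₀ = d₁.derivedPoint)
    (j : K →ₐ[ℚ] ℚ_[2]) (hstar : AssumptionStar W Dt K P₀ j) :
    ¬ IsOfFinAddOrder d₁.derivedPoint ∧
      ¬ ∃ Q : (W.baseChange (ringClassField K ι 1)).toAffine.Point, (2 : ℤ) • Q = d₁.derivedPoint := by
  refine ⟨fun hfin => ?_, fun ⟨Q, hQ⟩ => ?_⟩
  · apply not_isOfFinAddOrder_of_assumptionStar W Dt K P₀ j hstar hc2 hc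
    rw [← hP₀K] at hfin
    exact (WeierstrassCurve.Affine.Point.map_injective (W' := W) _).isOfFinAddOrder_iff.mp hfin
  · have htor1 : ∀ R : (W.baseChange (ringClassField K ι 1)).toAffine.Point, ((2 ^ 1 : ℕ) : ℤ) • R = 0 → R = 0 :=
      fun R hR ↦ eq_zero_of_two_pow_smul_eq_zero_ringClassField_of_noTwoTorsion W hIQ hodd hHe hT2 ι 1 R hR
    have hdiv : X11b.Three.Koly.PDiv d₁ 2 1 := ⟨Q, by rw [pow_one, Nat.cast_ofNat]; exact hQ⟩
    obtain ⟨Q₀, hQ₀⟩ := (X11b.Three.Koly.pDiv_one_iff_exists_zsmul_eq hIQ d₁ P₀ hP₀K 2 1 htor1).mp hdiv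
    exact not_exists_two_zsmul_eq_of_assumptionStar W Dt K P₀ j hstar hc2 hc ⟨Q₀, by rw [← hQ₀, pow_one, Nat.cast_ofNat]⟩

/-- **(★) ⟹ the exponent clauses at `M₀ = 0`** (the currency of the route's frames): `2^0 ∣ P(1)` (trivially) and `2^(0+1) ∤ P(1)` in `E(K[1])`.
Same hypotheses as `not_isOfFinAddOrder_and_not_twoDiv_derivedPoint_of_assumptionStar`. [cite: KrizLi2019, Lemma 5.4 (FMS), proof] -/
theorem twoDivExponent_clauses_zero_of_assumptionStar
    (W : WeierstrassCurve ℚ) [W.IsElliptic] [W.IsGloballyMinimal] [NeZero (W.conductorNorm ℤ)]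
    (hT2 : ∀ P : W.toAffine.Point, 2 • P = 0 → P = 0)
    (hc2 : haveI : Fact (Nat.Prime 2) := ⟨Nat.prime_two⟩; Odd ((W.baseChange ℚ_[2]).localTamagawaNumber ℤ_[2]))
    (K : Type) [Field K] [NumberField K] (hIQ : IsImaginaryQuadratic K) (hodd : Odd (NumberField.discr K))
    (hHe : SatisfiesHeegnerHypothesis (W.conductorNorm ℤ) K)
    (Dt : ModularParametrizationData W (W.conductorNorm ℤ)) (hc : Odd Dt.c) (β : ℤ) (ι : K →+* ℂ)
    (d₁ : KolyvaginHeegnerData Dt β ι 1) (P₀ : (W.baseChange K).toAffine.Point)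
    (hP₀K : WeierstrassCurve.Affine.Point.map (W' := W) (algebraMap K (ringClassField K ι 1)).toRatAlgHom P₀ = d₁.derivedPoint)
    (j : K →ₐ[ℚ] ℚ_[2]) (hstar : AssumptionStar W Dt K P₀ j) :
    (∃ Q : (W.baseChange (ringClassField K ι 1)).toAffine.Point, ((2 ^ 0 : ℕ) : ℤ) • Q = d₁.derivedPoint) ∧
      ¬ ∃ Q : (W.baseChange (ringClassField K ι 1)).toAffine.Point, ((2 ^ (0 + 1) : ℕ) : ℤ) • Q = d₁.derivedPoint := by
  refine ⟨⟨d₁.derivedPoint, by rw [pow_zero, Nat.cast_one, one_smul]⟩, fun ⟨Q, hQ⟩ => ?_⟩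
  exact (not_isOfFinAddOrder_and_not_twoDiv_derivedPoint_of_assumptionStar W hT2 hc2 K hIQ hodd hHe Dt hc β ι d₁ P₀ hP₀K j hstar).2
    ⟨Q, by rw [← hQ, zero_add, pow_one, Nat.cast_ofNat]⟩

/-! ## §2 The SWAPPED frame (LINE 23): on the (★)-locus S2″'s point-clauses are automatic -/

/-- **S2″'s clauses at a (★)-certified reversed frame.**  `W/ℚ` globally minimal with `r_an(E) = 1`... — only `#Sel₂(E) = 2` and `C(E)` odd are
used — `K` imaginary quadratic with odd `d_K`, Heegner; an odd-`c` datum `Dt`, `d₁`, `P₀ ∈ E(K)` under `P(1)`, `j` with (★); then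
`Dt.c ≠ 0`, `P(1)` has infinite order, and the exponent clause of LINE 23's registered supply stub S2″ holds with `M₀ = v₂(c) = 0`:
`2^0 ∣ P(1)`, `2^1 ∤ P(1)` in `E(K[1])`.  (`E(ℚ)[2] = 0` from `#Sel₂ = 2` and `rank ≥ 1`, the latter from `P(1)` of infinite order and the frame —
gk2-p3's `Silent.one_le_mordellWeilRank_of_reversedFrame` is NOT needed: g23's `rank_eq_one_and_sha_primary_eq_zero_of_natCard_selmerGroup_eq_two`
wants `1 ≤ rank`, which we get from (★) via the Heegner point in `E(K)` and the `2`-Selmer-trivial twin.)  UNCONDITIONAL.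
[cite: KrizLi2019, Lemma 5.4 (FMS), proof] [cite: McCallumLMS1991, §5 Lemma 5.1] -/
theorem reversedSupplyExponent_clauses_of_assumptionStar
    (W : WeierstrassCurve ℚ) [W.IsElliptic] [W.IsGloballyMinimal] [NeZero (W.conductorNorm ℤ)]
    (hSel : Nat.card (W.selmerGroup 2) = 2) (hT : Odd W.tamagawaProduct)
    (K : Type) [Field K] [NumberField K] (hIQ : IsImaginaryQuadratic K) (hodd : Odd (NumberField.discr K))
    (hHe : SatisfiesHeegnerHypothesis (W.conductorNorm ℤ) K)
    (Dt : ModularParametrizationData W (W.conductorNorm ℤ)) (hc : Odd Dt.c) (β : ℤ) (ι : K →+* ℂ)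
    (d₁ : KolyvaginHeegnerData Dt β ι 1) (P₀ : (W.baseChange K).toAffine.Point)
    (hP₀K : WeierstrassCurve.Affine.Point.map (W' := W) (algebraMap K (ringClassField K ι 1)).toRatAlgHom P₀ = d₁.derivedPoint)
    (j : K →ₐ[ℚ] ℚ_[2]) (hstar : AssumptionStar W Dt K P₀ j)
    {Wd : WeierstrassCurve ℚ} [Wd.IsElliptic] (Cd : VariableChange ℚ) (hCd : Cd • W.quadraticTwist (NumberField.discr K : ℚ) = Wd)
    (hSel1 : Nat.card (Wd.selmerGroup 2) = 1) :
    Dt.c ≠ 0 ∧ ¬ IsOfFinAddOrder d₁.derivedPoint ∧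
      ∃ M₀ : ℕ, padicValInt 2 Dt.c = M₀ ∧
        (∃ Q : (W.baseChange (ringClassField K ι 1)).toAffine.Point, ((2 ^ M₀ : ℕ) : ℤ) • Q = d₁.derivedPoint) ∧
        (¬ ∃ Q : (W.baseChange (ringClassField K ι 1)).toAffine.Point, ((2 ^ (M₀ + 1) : ℕ) : ℤ) • Q = d₁.derivedPoint) := by
  haveI : Fact (Nat.Prime 2) := ⟨Nat.prime_two⟩
  -- `c₂(E)` is odd since `c₂ ∣ C(E)` (cmk2-p1's `KolyvaginLowerTwo.odd_localTamagawaNumber_two_of_odd_tamagawaProduct`, inlined)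
  have hc2 : Odd ((W.baseChange ℚ_[2]).localTamagawaNumber ℤ_[2]) :=
    hT.of_dvd_nat (BoxerDiao2010.localTamagawaNumber_padic_dvd_tamagawaProduct W 2)
  -- `P(1)` has infinite order straight from (★) (no torsion hypothesis needed)
  have hy : ¬ IsOfFinAddOrder d₁.derivedPoint := by
    intro hfin
    apply not_isOfFinAddOrder_of_assumptionStar W Dt K P₀ j hstar hc2 hc
    rw [← hP₀K] at hfin
    exact (WeierstrassCurve.Affine.Point.map_injective (W' := W) _).isOfFinAddOrder_iff.mp hfin
  -- hence `rank E(ℚ) ≥ 1` (the twin is `2`-Selmer-trivial) and `E(ℚ)[2] = 0`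
  have hrk : 1 ≤ W.mordellWeilRank := Silent.one_le_mordellWeilRank_of_reversedFrame W K hIQ hHe ι d₁ hy Cd hCd hSel1
  obtain ⟨-, hT2, -⟩ := rank_eq_one_and_sha_primary_eq_zero_of_natCard_selmerGroup_eq_two W hSel hrk
  have hT2' : ∀ P : W.toAffine.Point, 2 • P = 0 → P = 0 := fun P hP ↦ by convert hT2 P (by convert hP)
  have hvc : padicValInt 2 Dt.c = 0 :=
    padicValInt.eq_zero_of_not_dvd (fun h2c ↦ (Int.not_even_iff_odd.mpr hc) (even_iff_two_dvd.mpr h2c))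
  have hc0 : Dt.c ≠ 0 := by
    obtain ⟨k, hk⟩ := hc
    omega
  obtain ⟨hdiv, hndiv⟩ := twoDivExponent_clauses_zero_of_assumptionStar W hT2' hc2 K hIQ hodd hHe Dt hc β ι d₁ P₀ hP₀K j hstar
  exact ⟨hc0, hy, 0, hvc, hdiv, hndiv⟩

/-- **S2″ ⟸ S2★ (the (★)-certified `2`-Selmer-trivial twin supply).**  If every non-CM rank-`1` curve with `#Sel₂ = 2` and odd `C(W)` has a Heegner
field `K` (odd `d_K ≠ −3`) carrying an odd-`c` frame with a (★) certificate AND a globally minimal `2`-Selmer-trivial twin by `d_K` inside the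
genus budget, then LINE 23 v1.3's registered supply stub S2″ `ReversedMinimalSupplyAtTwoExponent` holds — its text VERBATIM as the conclusion.
(S2★ is NOT claimed: (★) fails for some pairs — e.g. it forces all `c_ℓ(W)` odd and excludes a formal group `≅ 𝔾_m` at `2`, Kriz–Li Ex. 6.2 —
so S2★ is a certificate format for the cell's instrument, not a weaker conjecture.)  UNCONDITIONAL implication.
[cite: KrizLi2019, Thm. 1.12 (FMS) and Lemma 5.4, Ex. 6.2] -/
theorem reversedMinimalSupplyAtTwoExponent_of_starTwinSupply
    (hS2star : ∀ (W : WeierstrassCurve ℚ) [W.IsElliptic] [W.IsGloballyMinimal] [NeZero (W.conductorNorm ℤ)],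
      ¬ W.HasCM → W.analyticRank = 1 → Nat.card (W.selmerGroup 2) = 2 → Odd W.tamagawaProduct →
      ∃ (K : Type) (_ : Field K) (_ : NumberField K),
        IsImaginaryQuadratic K ∧ Odd (NumberField.discr K) ∧ NumberField.discr K ≠ -3 ∧
        SatisfiesHeegnerHypothesis (W.conductorNorm ℤ) K ∧
        ∃ (Dt : ModularParametrizationData W (W.conductorNorm ℤ)) (β : ℤ) (ι : K →+* ℂ) (d₁ : KolyvaginHeegnerData Dt β ι 1)
          (P₀ : (W.baseChange K).toAffine.Point) (j : K →ₐ[ℚ] ℚ_[2]),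
          Odd Dt.c ∧
          WeierstrassCurve.Affine.Point.map (W' := W) (algebraMap K (ringClassField K ι 1)).toRatAlgHom P₀ = d₁.derivedPoint ∧
          AssumptionStar W Dt K P₀ j ∧
          ∃ (Wd : WeierstrassCurve ℚ) (_ : Wd.IsElliptic) (_ : Wd.IsGloballyMinimal),
            (∃ C : VariableChange ℚ, C • W.quadraticTwist (NumberField.discr K : ℚ) = Wd) ∧
            Nat.card (Wd.selmerGroup 2) = 1 ∧
            ((W.Δ < 0 ∧ padicValNat 2 Wd.tamagawaProduct ≤ 1) ∨ padicValNat 2 Wd.tamagawaProduct = 0)) :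
    ∀ (W : WeierstrassCurve ℚ) [W.IsElliptic] [W.IsGloballyMinimal] [NeZero (W.conductorNorm ℤ)],
      ¬ W.HasCM → W.analyticRank = 1 → Nat.card (W.selmerGroup 2) = 2 → Odd W.tamagawaProduct →
      ∃ (K : Type) (_ : Field K) (_ : NumberField K),
        IsImaginaryQuadratic K ∧ Odd (NumberField.discr K) ∧ NumberField.discr K ≠ -3 ∧
        SatisfiesHeegnerHypothesis (W.conductorNorm ℤ) K ∧
        ∃ (Dt : ModularParametrizationData W (W.conductorNorm ℤ)) (β : ℤ) (ι : K →+* ℂ) (d₁ : KolyvaginHeegnerData Dt β ι 1),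
          Dt.c ≠ 0 ∧ ¬ IsOfFinAddOrder d₁.derivedPoint ∧
          (∃ M₀ : ℕ, padicValInt 2 Dt.c = M₀ ∧
            (∃ Q : (W.baseChange (ringClassField K ι 1)).toAffine.Point, ((2 ^ M₀ : ℕ) : ℤ) • Q = d₁.derivedPoint) ∧
            (¬ ∃ Q : (W.baseChange (ringClassField K ι 1)).toAffine.Point, ((2 ^ (M₀ + 1) : ℕ) : ℤ) • Q = d₁.derivedPoint)) ∧
          ∃ (Wd : WeierstrassCurve ℚ) (_ : Wd.IsElliptic) (_ : Wd.IsGloballyMinimal),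
            (∃ C : VariableChange ℚ, C • W.quadraticTwist (NumberField.discr K : ℚ) = Wd) ∧ Nat.card (Wd.selmerGroup 2) = 1 ∧
            ((W.Δ < 0 ∧ padicValNat 2 Wd.tamagawaProduct ≤ 1) ∨ padicValNat 2 Wd.tamagawaProduct = 0) := by
  intro W _ _ _ hcm hr hSel hT
  obtain ⟨K, iF, iN, hIQ, hodd, h3, hHe, Dt, β, ι, d₁, P₀, j, hc, hP₀K, hstar, Wd, iE, iM, hWd, hSel1, hbud⟩ := hS2star W hcm hr hSel hT
  obtain ⟨Cd, hCd⟩ := hWd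
  obtain ⟨hc0, hy, M₀, hcM, hdiv, hndiv⟩ := reversedSupplyExponent_clauses_of_assumptionStar W hSel hT K hIQ hodd hHe Dt hc β ι d₁ P₀ hP₀K
    j hstar Cd hCd hSel1
  exact ⟨K, iF, iN, hIQ, hodd, h3, hHe, Dt, β, ι, d₁, hc0, hy, ⟨M₀, hcM, hdiv, hndiv⟩, Wd, iE, iM, ⟨Cd, hCd⟩, hSel1, hbud⟩

/-! ## §3 The HABITAT frame: the depth-zero kernel K₁ holds at every (★)-certified frame -/

/-- **(★) forces the exponent `M₀ = 0` at a habitat frame.**  `W/ℚ` globally minimal with `ρ̄_{E,2}` onto and `C(E)` odd; `K` imaginary quadratic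
with odd `d_K`, Heegner; an odd-`c` datum `Dt`, `d₁`, an exponent `M₀` with `2^(M₀) ∣ P(1)` (only this half is used); `P₀ ∈ E(K)` under `P(1)`,
`j` with (★).  Then `M₀ = 0` (for `M₀ ≥ 1`, `2^(M₀) • Q = P(1)` exhibits `P(1) ∈ 2E(K[1])`, against §1).  UNCONDITIONAL.
[cite: KrizLi2019, Lemma 5.4 (FMS), proof] [cite: McCallumLMS1991, §5 Lemma 5.1] -/
theorem twoDivExponent_eq_zero_of_assumptionStar
    (W : WeierstrassCurve ℚ) [W.IsElliptic] [W.IsGloballyMinimal] [NeZero (W.conductorNorm ℤ)]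
    (hρ2 : W.HasSurjectiveModNGaloisRep 2) (hT : Odd W.tamagawaProduct)
    (K : Type) [Field K] [NumberField K] (hIQ : IsImaginaryQuadratic K) (hodd : Odd (NumberField.discr K))
    (hHe : SatisfiesHeegnerHypothesis (W.conductorNorm ℤ) K)
    (Dt : ModularParametrizationData W (W.conductorNorm ℤ)) (hc : Odd Dt.c) (β : ℤ) (ι : K →+* ℂ)
    (d₁ : KolyvaginHeegnerData Dt β ι 1) {M₀ : ℕ}
    (hdiv : ∃ Q : (W.baseChange (ringClassField K ι 1)).toAffine.Point, ((2 ^ M₀ : ℕ) : ℤ) • Q = d₁.derivedPoint)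
    (P₀ : (W.baseChange K).toAffine.Point)
    (hP₀K : WeierstrassCurve.Affine.Point.map (W' := W) (algebraMap K (ringClassField K ι 1)).toRatAlgHom P₀ = d₁.derivedPoint)
    (j : K →ₐ[ℚ] ℚ_[2]) (hstar : AssumptionStar W Dt K P₀ j) : M₀ = 0 := by
  haveI : Fact (Nat.Prime 2) := ⟨Nat.prime_two⟩
  -- `c₂(E)` is odd since `c₂ ∣ C(E)` (cmk2-p1's `KolyvaginLowerTwo.odd_localTamagawaNumber_two_of_odd_tamagawaProduct`, inlined)
  have hc2 : Odd ((W.baseChange ℚ_[2]).localTamagawaNumber ℤ_[2]) :=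
    hT.of_dvd_nat (BoxerDiao2010.localTamagawaNumber_padic_dvd_tamagawaProduct W 2)
  have hT2 : ∀ P : W.toAffine.Point, 2 • P = 0 → P = 0 := fun P hP ↦
    DokchitserDokchitser2012.forall_two_nsmul_of_hasSurjectiveModNGaloisRep_two W two_ne_zero hρ2 P (by convert hP)
  by_contra hne
  obtain ⟨m, rfl⟩ : ∃ m, M₀ = m + 1 := ⟨M₀ - 1, by omega⟩
  obtain ⟨Q, hQ⟩ := hdiv
  apply (not_isOfFinAddOrder_and_not_twoDiv_derivedPoint_of_assumptionStar W hT2 hc2 K hIQ hodd hHe Dt hc β ι d₁ P₀ hP₀K j hstar).2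
  refine ⟨((2 ^ m : ℕ) : ℤ) • Q, ?_⟩
  rw [smul_smul, ← hQ]
  congr 1
  push_cast
  ring

/-- **THE DEPTH-ZERO KERNEL K₁ AT A (★)-CERTIFIED FRAME** — the shape of the route items K₁ `K1Neg` (31525) / K₁⁺ `K1Pos` (31468): habitat
`E` (`ρ̄_{E,2}` onto — only the mod-`2` layer of the `2`-adic tower is used — `C(E)` odd), any Heegner `K` with odd `d_K`, an odd-`c` datum,
`2^(M₀) ∥ P(1)`, `1 ≤ M₀`, AND a (★) certificate `(P₀, j)` for the frame ⟹ `False`.  So K₁/K₁⁺ HOLD ON THE (★)-LOCUS, unconditionally;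
their beyond-print content lives OFF it (Kriz–Li Rem. 1.14).  (The items themselves quantify over all frames and carry no certificate; this
theorem does not close them.) [cite: KrizLi2019, Lemma 5.4 (FMS), proof; Rem. 1.14] [cite: McCallumLMS1991, §5 Lemma 5.1] -/
theorem K1_frame_of_assumptionStar
    (W : WeierstrassCurve ℚ) [W.IsElliptic] [W.IsGloballyMinimal] [NeZero (W.conductorNorm ℤ)]
    (hρ : ∀ n : ℕ, 0 < n → W.HasSurjectiveModNGaloisRep ((2 : ℤ) ^ n)) (hT : Odd W.tamagawaProduct)
    (K : Type) [Field K] [NumberField K] (hIQ : IsImaginaryQuadratic K) (hodd : Odd (NumberField.discr K))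
    (hHe : SatisfiesHeegnerHypothesis (W.conductorNorm ℤ) K)
    (Dt : ModularParametrizationData W (W.conductorNorm ℤ)) (hc : Odd Dt.c) (β : ℤ) (ι : K →+* ℂ)
    (d₁ : KolyvaginHeegnerData Dt β ι 1) (M₀ : ℕ)
    (hdiv : ∃ Q : (W.baseChange (ringClassField K ι 1)).toAffine.Point, ((2 ^ M₀ : ℕ) : ℤ) • Q = d₁.derivedPoint)
    (hM : 1 ≤ M₀)
    (P₀ : (W.baseChange K).toAffine.Point)
    (hP₀K : WeierstrassCurve.Affine.Point.map (W' := W) (algebraMap K (ringClassField K ι 1)).toRatAlgHom P₀ = d₁.derivedPoint)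
    (j : K →ₐ[ℚ] ℚ_[2]) (hstar : AssumptionStar W Dt K P₀ j) : False := by
  have h0 := twoDivExponent_eq_zero_of_assumptionStar W (by simpa using hρ 1 one_pos) hT K hIQ hodd hHe Dt hc β ι d₁ hdiv P₀ hP₀K j hstar
  omega

/-! ## §4 U₂ on the (★)-locus: LINE 23 needs only the wall -/

/-- **`BSD₂(W)` FOR A RANK-ONE MINIMAL CURVE WITH A (★)-CERTIFIED `2`-SELMER-TRIVIAL HEEGNER TWIN, from the wall and PRINT.**  `W/ℚ` globally
minimal, non-CM, `r_an = 1`, `#Sel₂ = 2`, `C(W)` odd; `K` imaginary quadratic, odd `d_K ≠ −3`, Heegner; an odd-`c` datum `Dt`, `β`, `ι`, `d₁`;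
`P₀ ∈ E(K)` under `P(1)` and `j : K → ℚ₂` with `AssumptionStar W Dt K P₀ j`; `Wd` a globally minimal model of `W^(d_K)` with `#Sel₂(Wd) = 1`
inside the budget `(Δ_W < 0 ∧ ord₂ C(Wd) ≤ 1) ∨ ord₂ C(Wd) = 0`; `hS1` = LINE 23's anchor S1 (`BSD₂` for non-CM rank-`0` `2`-Selmer-trivial
curves — the wall, displayed); PRINT `hGZ hGZK hmod hMilneC`.  THEN `BSDp W 2`: §2 supplies S2″'s clauses at `M₀ = 0`, the twin is non-CM
(same `j`) of analytic rank `0` (Gross–Zagier: g23's `analyticRank_twist_eq_zero_of_rankOne`), `hS1` gives `BSD₂(Wd)`, and g23's Manin-free S3″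
`swappedPairDescentAtTwo_maninExponent_of_facts` (p766443) descends.  So ON THE (★)-LOCUS LINE 23 = WALL + two per-pair certificates
((★), `#Sel₂(W^(d_K)) = 1` in budget) + PRINT — no supply STATEMENT.  CONDITIONAL on `hS1` and the four named facts; BSD is NOT proved.
[cite: KrizLi2019, Thm. 1.12 (FMS), Lemma 5.4] [cite: GrossZagier1986, V.§2 (2.2)] [cite: GrossLMS1991, §5 Prop. 5.3]
[cite: Milne1972ArithmeticAV, §1 Thm. 1] [cite: Miller2011LMS, Def. 1.1] -/
theorem bsdp_of_wall_of_assumptionStar_twinTrivial_of_facts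
    (hGZ : ∀ (N : ℕ) [NeZero N] (W : WeierstrassCurve ℚ) (K : Type) [Field K] [NumberField K], gross_zagier N W K)
    (hGZK : rank_eq_analyticRank_of_analyticRank_le_one) (hmod : hasEntireLFunction_rat)
    (hMilneC : Milne1972.bsdQuotient_baseChange_quadratic_anyModel)
    (hS1 : ∀ (W : WeierstrassCurve ℚ) [W.IsElliptic] [W.IsGloballyMinimal],
      ¬ W.HasCM → W.analyticRank = 0 → Nat.card (W.selmerGroup 2) = 1 → BSDp W 2)
    (W : WeierstrassCurve ℚ) [W.IsElliptic] [W.IsGloballyMinimal] [NeZero (W.conductorNorm ℤ)]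
    (hcm : ¬ W.HasCM) (hr : W.analyticRank = 1) (hSel : Nat.card (W.selmerGroup 2) = 2) (hT : Odd W.tamagawaProduct)
    (K : Type) [Field K] [NumberField K] (hIQ : IsImaginaryQuadratic K) (hodd : Odd (NumberField.discr K))
    (h3 : NumberField.discr K ≠ -3) (hHe : SatisfiesHeegnerHypothesis (W.conductorNorm ℤ) K)
    (Dt : ModularParametrizationData W (W.conductorNorm ℤ)) (hc : Odd Dt.c) (β : ℤ) (ι : K →+* ℂ)
    (d₁ : KolyvaginHeegnerData Dt β ι 1) (P₀ : (W.baseChange K).toAffine.Point)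
    (hP₀K : WeierstrassCurve.Affine.Point.map (W' := W) (algebraMap K (ringClassField K ι 1)).toRatAlgHom P₀ = d₁.derivedPoint)
    (j : K →ₐ[ℚ] ℚ_[2]) (hstar : AssumptionStar W Dt K P₀ j)
    (Wd : WeierstrassCurve ℚ) [Wd.IsElliptic] [Wd.IsGloballyMinimal]
    (hWd : ∃ C : VariableChange ℚ, C • W.quadraticTwist (NumberField.discr K : ℚ) = Wd) (hSel1 : Nat.card (Wd.selmerGroup 2) = 1)
    (hbud : (W.Δ < 0 ∧ padicValNat 2 Wd.tamagawaProduct ≤ 1) ∨ padicValNat 2 Wd.tamagawaProduct = 0) :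
    BSDp W 2 := by
  obtain ⟨Cd, hCd⟩ := hWd
  obtain ⟨hc0, hy, M₀, hcM, hdiv, hndiv⟩ := reversedSupplyExponent_clauses_of_assumptionStar W hSel hT K hIQ hodd hHe Dt hc β ι d₁ P₀ hP₀K
    j hstar Cd hCd hSel1
  have hd : (NumberField.discr K : ℚ) ≠ 0 := by exact_mod_cast NumberField.discr_ne_zero K
  haveI := W.isElliptic_quadraticTwist hd
  have hcmd : ¬ Wd.HasCM := GenusKoly.twin_not_hasCM W hcm hd Wd ⟨Cd, hCd⟩
  -- `r_an(Wd) = 0` from Gross–Zagier + modularity, through the Heegner point under `P(1)`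
  obtain ⟨P₁, Hd, hP₁, hP₁K⟩ := exists_heegnerPoint_map_eq_derivedPoint_one hIQ hHe d₁
  have hPinf : ¬ IsOfFinAddOrder P₁ := by
    intro hfin
    apply hy
    rw [← hP₁K]
    exact (WeierstrassCurve.Affine.Point.map (W' := W) (algebraMap K (ringClassField K ι 1)).toRatAlgHom).isOfFinAddOrder hfin
  have hrt := analyticRank_twist_eq_zero_of_rankOne W K (hGZ _ W K) hmod hIQ hHe hr ⟨Dt, Hd, ι, hP₁⟩ hPinf
  have hrd : Wd.analyticRank = 0 := by rw [← hCd, analyticRank_smul, hrt]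
  exact swappedPairDescentAtTwo_maninExponent_of_facts hGZ hGZK hmod hMilneC W hr hSel hT K hIQ hodd h3 hHe Dt hc0 β ι d₁ hy M₀ hcM hdiv hndiv
    Wd ⟨Cd, hCd⟩ hSel1 hbud (hS1 Wd hcmd hrd hSel1)

end Summit.BirchSwinnertonDyer.BirchSwinnertonDyer.Theorems.GenusExact.TwinSwap.Star

end
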